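import Literature.MathematicalPhysics.QuantumLattice.HubbardOpenBoxEDUpperCertificateNested
import HarnessLib

/-!
# Upper certificates: the SPLIT form of the kernel checker (nested loops of bounded depth, one kernel
# computation per quadratic form)

Topic `MathematicalPhysics/QuantumLattice`, family `hubbard`. `UpperCert.check` / `check₂`
(`HubbardOpenBoxEDUpperCertificate(Nested)`) evaluate all four quadratic forms, the norm and the support
test in ONE kernel command with loops of depth `4^{ab}` resp. `2^{ab}`; for the `2 × 4` cluster this exceeds
the kernel's recursion depth / per-command budget. Here every outer loop is a NEST of `L` loops of length
`B` (`sumNest`, `allNest`, with `sumNest_eq : sumNest f B L off = Σ_{m < B^L} f (off + m)`), the four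
integer sums `SHop₃`, `SD₃`, `NN₃` and the support test `supp₃` are separate definitions (so a certificate
file evaluates each in its own `decide +kernel` theorem and states its VALUE), and **`UpperCert.sound₃`**
assembles: `B^L = 4^{ab}`, the support test, `0 < NN₃` and the four rational inequalities between the
stated values give the witness plane of `UpperCert.sound`. Nothing numerical; everything proved.

## References

* A. Neumaier, Acta Numerica 13 (2004), §11. [cite: Neumaier2004CompleteSearch, §11]
* D. Ruelle, *Statistical Mechanics: Rigorous Results* (1969), §3.3. [cite: Ruelle1969, §3.3]
-/

namespace Literature.MathematicalPhysics.QuantumLattice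

namespace OccupationCode

open Finset

/-- Nested structural sum: `sumNest f B L off = Σ_{m < B^L} f (off + m)` as `L` nested loops of length `B`.
[cite: Neumaier2004CompleteSearch, §11] -/
def sumNest {α : Type*} [AddCommMonoid α] (f : ℕ → α) (B : ℕ) : ℕ → ℕ → α
  | 0, off => f off
  | L + 1, off => sumNat (fun i => sumNest f B L (off + i * B ^ L)) B

/-- `sumNest f B L off = Σ_{m < B^L} f (off + m)`. [cite: Neumaier2004CompleteSearch, §11] -/
theorem sumNest_eq {α : Type*} [AddCommMonoid α] (f : ℕ → α) (B : ℕ) :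
    ∀ (L off : ℕ), sumNest f B L off = sumNat (fun m => f (off + m)) (B ^ L)
  | 0, off => by simp [sumNest, sumNat]
  | L + 1, off => by
    rw [sumNest, pow_succ, Nat.mul_comm, sumNat_mul]
    refine congrArg (fun g => sumNat g B) (funext fun i => ?_)
    rw [sumNest_eq f B L]
    refine congrArg (fun g => sumNat g (B ^ L)) (funext fun j => ?_)
    rw [Nat.add_assoc]

/-- Nested structural conjunction: `allNest f B L off = ∀ m < B^L, f (off + m)`. [cite: Neumaier2004CompleteSearch, §11] -/
def allNest (f : ℕ → Bool) (B : ℕ) : ℕ → ℕ → Bool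
  | 0, off => f off
  | L + 1, off => allNat (fun i => allNest f B L (off + i * B ^ L)) B

/-- `allNest f B L off = allNat (fun m => f (off + m)) (B^L)`. [cite: Neumaier2004CompleteSearch, §11] -/
theorem allNest_eq (f : ℕ → Bool) (B : ℕ) :
    ∀ (L off : ℕ), allNest f B L off = allNat (fun m => f (off + m)) (B ^ L)
  | 0, off => by simp [allNest, allNat]
  | L + 1, off => by
    rw [allNest, pow_succ, Nat.mul_comm, allNat_mul]
    refine congrArg (fun g => allNat g B) (funext fun i => ?_)
    rw [allNest_eq f B L]
    refine congrArg (fun g => allNat g (B ^ L)) (funext fun j => ?_)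
    rw [Nat.add_assoc]

/-- Structural sums agree when their summands agree below the bound. [cite: Neumaier2004CompleteSearch, §11] -/
theorem sumNat_congr {α : Type*} [AddCommMonoid α] {f g : ℕ → α} :
    ∀ {n : ℕ}, (∀ i < n, f i = g i) → sumNat f n = sumNat g n
  | 0, _ => by simp [sumNat]
  | n + 1, h => by
    rw [sumNat, sumNat, sumNat_congr (fun i hi => h i (Nat.lt_succ_of_lt hi)), h n (Nat.lt_succ_self n)]

/-- **Parts of a nested sum**: if the `B` top-level blocks have the values `v i`, the whole nested sum is
`sumNat v B` (lets a certificate file evaluate one block per kernel command). [cite: Neumaier2004CompleteSearch, §11] -/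
theorem sumNest_parts {α : Type*} [AddCommMonoid α] {f : ℕ → α} {B L : ℕ} (v : ℕ → α)
    (h : ∀ i < B, sumNest f B L (i * B ^ L) = v i) : sumNest f B (L + 1) 0 = sumNat v B := by
  rw [sumNest]
  exact sumNat_congr fun i hi => by rw [Nat.zero_add]; exact h i hi

/-- `allNat f n = true` from `f i = true` for all `i < n`. [cite: Neumaier2004CompleteSearch, §11] -/
theorem allNat_of_forall {f : ℕ → Bool} : ∀ {n : ℕ}, (∀ i < n, f i = true) → allNat f n = true
  | 0, _ => by simp [allNat]
  | n + 1, h => by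
    rw [allNat, Bool.and_eq_true]
    exact ⟨allNat_of_forall (fun i hi => h i (Nat.lt_succ_of_lt hi)), h n (Nat.lt_succ_self n)⟩

/-- **Parts of a nested conjunction**: if every top-level block passes, the whole passes.
[cite: Neumaier2004CompleteSearch, §11] -/
theorem allNest_parts {f : ℕ → Bool} {B L : ℕ} (h : ∀ i < B, allNest f B L (i * B ^ L) = true) :
    allNest f B (L + 1) 0 = true := by
  rw [allNest]
  exact allNat_of_forall fun i hi => by rw [Nat.zero_add]; exact h i hi

namespace UpperCert

variable (C : UpperCert)

/-- Split form of `SHop`. [cite: Neumaier2004CompleteSearch, §11] -/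
def SHop₃ (adj : ℕ → ℕ → Bool) (a b B L : ℕ) : ℤ :=
  sumNest (fun m => if C.fAt m = 0 then 0 else C.fAt m * openBoxHopApply adj (a * b) m C.fAt) B L 0

/-- Split form of `SD`. [cite: Neumaier2004CompleteSearch, §11] -/
def SD₃ (a b B L : ℕ) : ℤ :=
  sumNest (fun m => if C.fAt m = 0 then 0 else doccOf (a * b) m * (C.fAt m * C.fAt m)) B L 0

/-- Split form of `NN`. [cite: Neumaier2004CompleteSearch, §11] -/
def NN₃ (B L : ℕ) : ℤ := sumNest (fun m => C.fAt m * C.fAt m) B L 0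

/-- Split form of the support test. [cite: Neumaier2004CompleteSearch, §11] -/
def supp₃ (a b N B L : ℕ) : Bool :=
  allNest (fun m => decide (upCount (a * b) m + dnCount (a * b) m = N) || decide (C.fAt m = 0)) B L 0

/-- `SHop₃ = SHop` when `B^L = 4^{ab}`. [cite: Neumaier2004CompleteSearch, §11] -/
theorem SHop₃_eq (adj : ℕ → ℕ → Bool) {a b B L : ℕ} (h : B ^ L = 4 ^ (a * b)) : C.SHop₃ adj a b B L = C.SHop adj a b := by
  rw [SHop₃, sumNest_eq, h, SHop]; simp only [Nat.zero_add]

/-- `SD₃ = SD` when `B^L = 4^{ab}`. [cite: Neumaier2004CompleteSearch, §11] -/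
theorem SD₃_eq {a b B L : ℕ} (h : B ^ L = 4 ^ (a * b)) : C.SD₃ a b B L = C.SD a b := by
  rw [SD₃, sumNest_eq, h, SD]; simp only [Nat.zero_add]

/-- `NN₃ = NN` when `B^L = 4^{ab}`. [cite: Neumaier2004CompleteSearch, §11] -/
theorem NN₃_eq {a b B L : ℕ} (h : B ^ L = 4 ^ (a * b)) : C.NN₃ B L = C.NN a b := by
  rw [NN₃, sumNest_eq, h, NN]; simp only [Nat.zero_add]

/-- **SOUNDNESS of the split checker.** If `B^L = 4^{ab}`, the support test passes, `0 < NN₃`, and the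
four rational inequalities hold between the (separately kernel-evaluated) integer sums, then the witness
plane holds for all `t'` and all `U ≥ 0`. [cite: Ruelle1969, §3.3] -/
theorem sound₃ {a b N B L : ℕ} {EK EP EM ED : ℚ} (hBL : B ^ L = 4 ^ (a * b))
    (hsupp : C.supp₃ a b N B L = true) (hNN : 0 < C.NN₃ B L)
    (hK : (-(C.SHop₃ (nnAdjCode b) a b B L) : ℚ) ≤ EK * C.NN₃ B L)
    (hP : (-(C.SHop₃ (diagAdjCode b) a b B L) : ℚ) ≤ EP * C.NN₃ B L)
    (hM : ((C.SHop₃ (diagAdjCode b) a b B L) : ℚ) ≤ EM * C.NN₃ B L)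
    (hD : ((C.SD₃ a b B L) : ℚ) ≤ ED * C.NN₃ B L)
    (ha : 1 ≤ a) (hb : 1 ≤ b) (hN : N < 2 * (a * b)) (t' : ℝ) {U : ℝ} (hU : 0 ≤ U) :
    ThermodynamicLimit.energyDensityTT' 1 t' U ((N : ℝ) / ((a : ℝ) * (b : ℝ))) ≤
      ((EK : ℝ) + max (t' * EP) (-t' * EM) + U * ED) / ((a : ℝ) * (b : ℝ)) := by
  rw [C.SHop₃_eq _ hBL] at hK
  rw [C.SHop₃_eq _ hBL] at hP hM
  rw [C.SD₃_eq hBL] at hD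
  rw [C.NN₃_eq hBL] at hNN hK hP hM hD
  have hs : allNat (fun m => decide (upCount (a * b) m + dnCount (a * b) m = N) || decide (C.fAt m = 0)) (4 ^ (a * b)) = true := by
    rw [supp₃, allNest_eq, hBL] at hsupp
    simpa only [Nat.zero_add] using hsupp
  refine C.sound ?_ ha hb hN t' hU
  simp only [check, Bool.and_eq_true, decide_eq_true_eq]
  exact ⟨⟨⟨⟨⟨hNN, hs⟩, hK⟩, hP⟩, hM⟩, hD⟩

end UpperCert

end OccupationCode

end Literature.MathematicalPhysics.QuantumLattice
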